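import Mathlib
import HarnessLib
import Summits.NavierStokesRegularity.NavierStokesRegularity.Theorems.PoloidalWindowDoorPoloidalWindowRigidityStructureFunctionSlope
import Summits.NavierStokesRegularity.NavierStokesRegularity.Theorems.PoloidalWindowDoorPoloidalWindowRigidityConstantShearMeans

/-!
# Route `PoloidalWindowDoor`, item `LrcModEntire` (stmt-NavierStokesRegularity-20428) / crux K2 (stmt-19708) — the normal form in
# `q`-COORDINATES: the pin `∂_b q = ∂₂v_b` and T0 `Δφ + A_q ∂₂q + A_z = 0` (K2P1-LOCAL-NOTES §1(e)) in the kernel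

Cell ns-regularity-ideate, seat ns-poloidal-K2-p3 gen 5 (LEAD of item 20428; file landed `--supports stmt-NavierStokesRegularity-20428`
as a helper).  Sequel to this seat's `…StructureFunction` (p531376: near a point with `∂_b(v₂ − ψ) ≠ 0`, `ψ = A(t, q, x₂)` with
`q := v₂ − ψ = ∂₂φ`) and `…StructureFunctionSlope` (p533778: differentiated structure-function identities).  Two assembly steps of the
structural route's pressure-free normal form `v = (∂₀φ, ∂₁φ, q + A(t,q,x₂))` (K2 lead g3/g5, K2P1-LOCAL-NOTES §1(e); there `A` is written `A_q`):

* `fderiv_q_eq_fderiv_vertical` — **the pin in the stub's currency**: for the tree's Clebsch pair (`∂_bφ = v_b`, `v₂ = ∂₂φ + ψ`, slices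
  `C²`), `∂_b(v₂ − ψ)(t,·)(y) = ∂₂v_b(t,y)` for horizontal `b` (symmetry of the mixed partials of `φ t`) — so the hypothesis
  `∂_b(v₂ − ψ) ≠ 0` of `exists_clebsch_eq_structureFunction_q` IS the registered stubs' non-degeneracy `∂₂v_h ≠ 0`;
* `exists_structureFunction_q_slope` — class + poloidal + `ψ` (`Cⁿ`, carrying the vorticity) + `∂_b(v₂ − ψ)(t₀,·)(y₀) ≠ 0` ⇒
  `∃ A` (`Cⁿ` at `(t₀, q₀, (y₀)₂)`) with `ψ = A(t, q, x₂)` near `(t₀,y₀)` AND `D(ψ t)(y) e = A_q · D(q t)(y) e + e₂ · A_z` near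
  `(t₀,y₀)` (`q t = v₂(t,·) − ψ t`);
* `exists_T0` — **T0**: with the tree's jointly smooth Clebsch pair (E1 `Δ(φ t) + ∂₂(ψ t) = 0`) at a point with `∂₂v_h(t₀,y₀) ≠ 0`:
  `∃ A`, `C^∞` at the base point, with `ψ = A(t, q, x₂)` and **`Δ(φ t)(y) + A_q(t, q, y₂) · ∂₂q(t,·)(y) + A_z(t, q, y₂) = 0`** for all
  `(t, y)` near `(t₀, y₀)`, `q = ∂₂φ` — verbatim `Δφ + ∂₃[A_q(φ_z, z, t)] = 0` of K2P1-LOCAL-NOTES §1(e).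

WHAT THIS IS NOT: not a claim about Navier–Stokes regularity, not Dyn and not the stub — kinematic bookkeeping of the normal form
(bears_on LADDER-NS N0 via items 20428 / 19708).
-/

noncomputable section

-- the summit and its single sub-problem share the name (CONVENTIONS §1), as in every Theorems file
set_option linter.dupNamespace false

namespace Summit.NavierStokesRegularity.NavierStokesRegularity.Theorems.PoloidalWindowDoorLrcModEntireStructureFunctionT0

open Set Function Filter Topology Metric
open scoped RealInnerProductSpace InnerProductSpace Laplacian ContDiff
open Literature.Analysis Literature.Analysis.FluidPDE
open Summit.NavierStokesRegularity.NavierStokesRegularity.Theorems.LocalSineTubeDoorProfileAlignedWindowRigidityAncient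
open Summit.NavierStokesRegularity.NavierStokesRegularity.Theorems.PoloidalWindowDoorPoloidalWindowRigidityClebsch
open Summit.NavierStokesRegularity.NavierStokesRegularity.Theorems.PoloidalWindowDoorPoloidalWindowRigidityStructureFunction
open Summit.NavierStokesRegularity.NavierStokesRegularity.Theorems.PoloidalWindowDoorPoloidalWindowRigidityStructureFunctionSlope
open Summit.NavierStokesRegularity.NavierStokesRegularity.Theorems.PoloidalWindowDoorPoloidalWindowRigidityConstantShearMeans

variable {C : ℝ} {v : ℝ → EuclideanSpace ℝ (Fin 3) → EuclideanSpace ℝ (Fin 3)}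

/-! ### The pin `∂_b q = ∂₂ v_b` -/

/-- **`∂_b(v₂ − ψ) = ∂₂v_b` for the Clebsch pair.**  If `φ ∈ C²` with `∂_bφ = V_b` (`b` horizontal) and `V₂ = ∂₂φ + ψ`
pointwise, then `∂_b(V₂ − ψ)(y) = ∂_b∂₂φ(y) = ∂₂∂_bφ(y) = ∂₂V_b(y)` — the `q`-pin of `exists_clebsch_eq_structureFunction_q` is
the registered non-degeneracy `∂₂v_b ≠ 0`. -/
theorem fderiv_q_eq_fderiv_vertical {φ ψ : EuclideanSpace ℝ (Fin 3) → ℝ} {V : EuclideanSpace ℝ (Fin 3) → EuclideanSpace ℝ (Fin 3)}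
    (hφ : ContDiff ℝ 2 φ) (hV : Differentiable ℝ V) {b : Fin 3}
    (hb : ∀ y, fderiv ℝ φ y (EuclideanSpace.single b 1) = V y b)
    (h2 : ∀ y, V y 2 = fderiv ℝ φ y (EuclideanSpace.single 2 1) + ψ y) (y : EuclideanSpace ℝ (Fin 3)) :
    fderiv ℝ (fun y' => V y' 2 - ψ y') y (EuclideanSpace.single b 1) =
      fderiv ℝ V y (EuclideanSpace.single 2 1) b := by
  -- `V₂ − ψ = ∂₂φ` as functions
  have hq : (fun y' => V y' 2 - ψ y') = fun y' => fderiv ℝ φ y' (EuclideanSpace.single 2 1) := by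
    funext y'; rw [h2 y']; ring
  -- `V_b = ∂_bφ` as functions
  have hvb : (fun y' => V y' b) = fun y' => fderiv ℝ φ y' (EuclideanSpace.single b 1) := by
    funext y'; rw [hb y']
  rw [hq, fderiv_fderiv_symm hφ, ← fderiv_coord_apply (hV y) b, hvb]

/-! ### The differentiated `q`-structure function -/

/-- **`ψ = A(t, q, x₂)` with its first-order identities.**  For a profile of the route's Type-I class, poloidal along `e₃`, and a
`Cⁿ` space–time `ψ` carrying the vorticity as `ω = (∂₁ψ, −∂₀ψ, 0)`: near a point `(t₀, y₀)` of the slab with `∂_b(v₂ − ψ)(t₀,·)(y₀) ≠ 0`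
for a horizontal `b`, there is `A : ℝ × ℝ × ℝ → ℝ`, `Cⁿ` at `(t₀, v₂(t₀,y₀) − ψ(t₀,y₀), (y₀)₂)`, with `ψ t y = A(t, q t y, y₂)` near
`(t₀,y₀)` AND `D(ψ t)(y) e = A_q(t, q t y, y₂) · D(q t)(y) e + e₂ · A_z(t, q t y, y₂)` near `(t₀,y₀)`, where `q t y = v t y 2 − ψ t y`
(`A_q = DA(0,1,0)`, `A_z = DA(0,0,1)`). -/
theorem exists_structureFunction_q_slope {n : WithTop ℕ∞} (hn : n ≠ 0)
    (hrate : HasTypeITimeDecay C v)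
    (hcont : ContinuousOn (uncurry v) (Iio (0 : ℝ) ×ˢ univ))
    (hmild : ∀ s t : ℝ, s < t → t < 0 → ∀ x,
      v t x = UnboundedOperators.heatExtension (v s) (t - s) x - oseenDuhamel 1 s v v t x)
    (hdiv : ∀ t < 0, VectorCalculus.IsDivFree (v t))
    (hpol : ∀ s < 0, ∀ y, ⟪curl (v s) y, EuclideanSpace.single 2 1⟫_ℝ = 0)
    {ψ : ℝ → EuclideanSpace ℝ (Fin 3) → ℝ} {t₀ : ℝ} {y₀ : EuclideanSpace ℝ (Fin 3)} (ht₀ : t₀ < 0)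
    (hψ : ContDiffAt ℝ n (uncurry ψ) (t₀, y₀))
    (hω : ∀ t < 0, ∀ y, curl (v t) y 0 = fderiv ℝ (ψ t) y (EuclideanSpace.single 1 1) ∧
      curl (v t) y 1 = -fderiv ℝ (ψ t) y (EuclideanSpace.single 0 1))
    (hne : fderiv ℝ (fun y => v t₀ y 2 - ψ t₀ y) y₀ (EuclideanSpace.single 0 1) ≠ 0 ∨
      fderiv ℝ (fun y => v t₀ y 2 - ψ t₀ y) y₀ (EuclideanSpace.single 1 1) ≠ 0) :
    ∃ A : ℝ × ℝ × ℝ → ℝ, ContDiffAt ℝ n A (t₀, v t₀ y₀ 2 - ψ t₀ y₀, y₀ 2) ∧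
      (∀ᶠ z in 𝓝 (t₀, y₀), ψ z.1 z.2 = A (z.1, v z.1 z.2 2 - ψ z.1 z.2, z.2 2)) ∧
      ∀ᶠ z in 𝓝 (t₀, y₀), ∀ e : EuclideanSpace ℝ (Fin 3),
        fderiv ℝ (ψ z.1) z.2 e =
          fderiv ℝ A (z.1, v z.1 z.2 2 - ψ z.1 z.2, z.2 2) ((0 : ℝ), (1 : ℝ), (0 : ℝ)) *
              fderiv ℝ (fun y => v z.1 y 2 - ψ z.1 y) z.2 e +
            e 2 * fderiv ℝ A (z.1, v z.1 z.2 2 - ψ z.1 z.2, z.2 2) ((0 : ℝ), (0 : ℝ), (1 : ℝ)) := by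
  have hn1 : (1 : WithTop ℕ∞) ≤ n := ENat.one_le_iff_ne_zero_withTop.mpr hn
  obtain ⟨A, hAc, hAeq⟩ := exists_clebsch_eq_structureFunction_q hn hrate hcont hmild hdiv hpol ht₀ hψ hω hne
  refine ⟨A, hAc, hAeq, ?_⟩
  -- the space–time function `q = v₂ − ψ`
  have hanV := analyticOnNhd_uncurry hcont (bdd_of_hasTypeITimeDecay hrate) hmild
  have hmem : (t₀, y₀) ∈ Iio (0 : ℝ) ×ˢ (univ : Set (EuclideanSpace ℝ (Fin 3))) :=
    mem_prod.2 ⟨show t₀ < 0 from ht₀, mem_univ _⟩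
  have hslab : Iio (0 : ℝ) ×ˢ (univ : Set (EuclideanSpace ℝ (Fin 3))) ∈ 𝓝 (t₀, y₀) :=
    (isOpen_Iio.prod isOpen_univ).mem_nhds hmem
  set q : ℝ → EuclideanSpace ℝ (Fin 3) → ℝ := fun t y => v t y 2 - ψ t y with hq
  have hψd : ∀ᶠ z in 𝓝 (t₀, y₀), DifferentiableAt ℝ (uncurry ψ) z :=
    ((hψ.of_le hn1).eventually (by simp)).mono fun z hz => hz.differentiableAt one_ne_zero
  have hv2d : ∀ᶠ z in 𝓝 (t₀, y₀), DifferentiableAt ℝ (fun p : ℝ × EuclideanSpace ℝ (Fin 3) => v p.1 p.2 2) z := by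
    filter_upwards [hslab] with z hz
    exact ((EuclideanSpace.proj (2 : Fin 3) : EuclideanSpace ℝ (Fin 3) →L[ℝ] ℝ).differentiableAt).comp _
      (hanV z hz).differentiableAt
  have hqd : ∀ᶠ z in 𝓝 (t₀, y₀), DifferentiableAt ℝ (uncurry q) z := by
    filter_upwards [hψd, hv2d] with z h1 h2
    have e : uncurry q = fun p : ℝ × EuclideanSpace ℝ (Fin 3) => v p.1 p.2 2 - uncurry ψ p := by
      funext p; rfl
    rw [e]; exact h2.sub h1
  have hqc : ContinuousAt (uncurry q) (t₀, y₀) := by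
    have h1 : ContinuousAt (uncurry ψ) (t₀, y₀) := hψ.continuousAt
    have h2 : ContinuousAt (fun p : ℝ × EuclideanSpace ℝ (Fin 3) => v p.1 p.2 2) (t₀, y₀) :=
      ((EuclideanSpace.proj (2 : Fin 3) : EuclideanSpace ℝ (Fin 3) →L[ℝ] ℝ).continuous.continuousAt).comp
        (hanV _ hmem).continuousAt
    have e : uncurry q = fun p : ℝ × EuclideanSpace ℝ (Fin 3) => v p.1 p.2 2 - uncurry ψ p := by
      funext p; rfl
    rw [e]; exact h2.sub h1
  have hAc' : ContDiffAt ℝ n A (t₀, q t₀ y₀, y₀ 2) := hAc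
  have hAeq' : ∀ᶠ z in 𝓝 (t₀, y₀), ψ z.1 z.2 = A (z.1, q z.1 z.2, z.2 2) := hAeq
  exact fderiv_slice_eq_of_eq_structureFunction (f := ψ) (g := q) hn hqd hAc' hqc hAeq'

/-! ### T0 in `q`-coordinates -/

/-- **T0 (K2P1-LOCAL-NOTES §1(e)) for the Clebsch pair of a poloidal class profile.**  For a profile of the route's Type-I class,
poloidal along `e₃`, there are `φ ψ : ℝ → ℝ³ → ℝ`, jointly `C^∞` on the slab, with `v t = ∇(φ t) + (ψ t) e₂` (coordinates
`∂₀φ = v₀`, `∂₁φ = v₁`, `v₂ = ∂₂φ + ψ`), `curl (v t) = (∂₁ψ, −∂₀ψ, 0)` and (E1) `Δ(φ t) + ∂₂(ψ t) = 0`, such that near EVERY point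
`(t₀, y₀)` of the slab with `∂₂v₀(t₀,y₀) ≠ 0 ∨ ∂₂v₁(t₀,y₀) ≠ 0` there is a structure function `A`, `C^∞` at
`(t₀, ∂₂φ(t₀,y₀), (y₀)₂)`, with `ψ = A(t, q, y₂)`, `q = v₂ − ψ = ∂₂φ`, and
**`Δ(φ t)(y) + A_q(t, q t y, y₂) · ∂₂(q t)(y) + A_z(t, q t y, y₂) = 0`** for all `(t,y)` near `(t₀,y₀)`. -/
theorem exists_T0 (hrate : HasTypeITimeDecay C v)
    (hcont : ContinuousOn (uncurry v) (Iio (0 : ℝ) ×ˢ univ))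
    (hmild : ∀ s t : ℝ, s < t → t < 0 → ∀ x,
      v t x = UnboundedOperators.heatExtension (v s) (t - s) x - oseenDuhamel 1 s v v t x)
    (hdiv : ∀ t < 0, VectorCalculus.IsDivFree (v t))
    (hpol : ∀ s < 0, ∀ y, ⟪curl (v s) y, EuclideanSpace.single 2 1⟫_ℝ = 0) :
    ∃ φ ψ : ℝ → EuclideanSpace ℝ (Fin 3) → ℝ,
      ContDiffOn ℝ ∞ (uncurry φ) (Iio (0 : ℝ) ×ˢ univ) ∧ ContDiffOn ℝ ∞ (uncurry ψ) (Iio (0 : ℝ) ×ˢ univ) ∧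
      (∀ t < 0,
        (∀ y, fderiv ℝ (φ t) y (EuclideanSpace.single 0 1) = v t y 0) ∧
        (∀ y, fderiv ℝ (φ t) y (EuclideanSpace.single 1 1) = v t y 1) ∧
        (∀ y, v t y 2 = fderiv ℝ (φ t) y (EuclideanSpace.single 2 1) + ψ t y) ∧
        (∀ y, curl (v t) y 0 = fderiv ℝ (ψ t) y (EuclideanSpace.single 1 1) ∧
          curl (v t) y 1 = -fderiv ℝ (ψ t) y (EuclideanSpace.single 0 1) ∧ curl (v t) y 2 = 0) ∧
        (∀ y, (Δ (φ t)) y + fderiv ℝ (ψ t) y (EuclideanSpace.single 2 1) = 0)) ∧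
      ∀ t₀ < 0, ∀ y₀ : EuclideanSpace ℝ (Fin 3),
        (fderiv ℝ (v t₀) y₀ (EuclideanSpace.single 2 1) 0 ≠ 0 ∨ fderiv ℝ (v t₀) y₀ (EuclideanSpace.single 2 1) 1 ≠ 0) →
        ∃ A : ℝ × ℝ × ℝ → ℝ, ContDiffAt ℝ ∞ A (t₀, v t₀ y₀ 2 - ψ t₀ y₀, y₀ 2) ∧
          (∀ᶠ z in 𝓝 (t₀, y₀), ψ z.1 z.2 = A (z.1, v z.1 z.2 2 - ψ z.1 z.2, z.2 2)) ∧
          ∀ᶠ z in 𝓝 (t₀, y₀),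
            (Δ (φ z.1)) z.2 +
                fderiv ℝ A (z.1, v z.1 z.2 2 - ψ z.1 z.2, z.2 2) ((0 : ℝ), (1 : ℝ), (0 : ℝ)) *
                  fderiv ℝ (fun y => v z.1 y 2 - ψ z.1 y) z.2 (EuclideanSpace.single 2 1) +
              fderiv ℝ A (z.1, v z.1 z.2 2 - ψ z.1 z.2, z.2 2) ((0 : ℝ), (0 : ℝ), (1 : ℝ)) = 0 := by
  obtain ⟨φ, ψ, hφs, hψs, hall⟩ := exists_clebsch_uncurry hrate hcont hmild hdiv hpol
  refine ⟨φ, ψ, hφs, hψs, fun t ht => ⟨(hall t ht).1, (hall t ht).2.1, (hall t ht).2.2.1, (hall t ht).2.2.2.2.1,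
    (hall t ht).2.2.2.2.2⟩, fun t₀ ht₀ y₀ hne => ?_⟩
  have hmem : (t₀, y₀) ∈ Iio (0 : ℝ) ×ˢ (univ : Set (EuclideanSpace ℝ (Fin 3))) :=
    mem_prod.2 ⟨show t₀ < 0 from ht₀, mem_univ _⟩
  have hslab : Iio (0 : ℝ) ×ˢ (univ : Set (EuclideanSpace ℝ (Fin 3))) ∈ 𝓝 (t₀, y₀) :=
    (isOpen_Iio.prod isOpen_univ).mem_nhds hmem
  have hψ : ContDiffAt ℝ ∞ (uncurry ψ) (t₀, y₀) := hψs.contDiffAt hslab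
  -- the slice `φ t₀` is `C²` and the pin converts
  have hφslice : ContDiff ℝ 2 (φ t₀) := by
    have h1 : ContDiffOn ℝ 2 (uncurry φ) (Iio (0 : ℝ) ×ˢ univ) := hφs.of_le (by norm_cast)
    have h2 : ContDiff ℝ 2 (fun y : EuclideanSpace ℝ (Fin 3) => ((t₀, y) : ℝ × EuclideanSpace ℝ (Fin 3))) :=
      contDiff_const.prodMk contDiff_id
    have h3 : ContDiffOn ℝ 2 (uncurry φ ∘ fun y : EuclideanSpace ℝ (Fin 3) => ((t₀, y) : ℝ × EuclideanSpace ℝ (Fin 3)))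
        univ := h1.comp h2.contDiffOn fun y _ => mem_prod.2 ⟨show t₀ < 0 from ht₀, mem_univ _⟩
    exact contDiffOn_univ.1 h3
  have hVd : Differentiable ℝ (v t₀) := fun y =>
    (analyticOnNhd_slice hcont (bdd_of_hasTypeITimeDecay hrate) hmild ht₀ y (mem_univ y)).differentiableAt
  have hpin : fderiv ℝ (fun y => v t₀ y 2 - ψ t₀ y) y₀ (EuclideanSpace.single 0 1) ≠ 0 ∨
      fderiv ℝ (fun y => v t₀ y 2 - ψ t₀ y) y₀ (EuclideanSpace.single 1 1) ≠ 0 := by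
    rcases hne with h0 | h1
    · left
      rwa [fderiv_q_eq_fderiv_vertical hφslice hVd (hall t₀ ht₀).1 (hall t₀ ht₀).2.2.1 y₀]
    · right
      rwa [fderiv_q_eq_fderiv_vertical hφslice hVd (hall t₀ ht₀).2.1 (hall t₀ ht₀).2.2.1 y₀]
  obtain ⟨A, hAc, hAeq, hslope⟩ := exists_structureFunction_q_slope (by simp) hrate hcont hmild hdiv hpol ht₀ hψ
    (fun t ht y => ⟨((hall t ht).2.2.2.2.1 y).1, ((hall t ht).2.2.2.2.1 y).2.1⟩) hpin
  refine ⟨A, hAc, hAeq, ?_⟩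
  have ht : ∀ᶠ z : ℝ × EuclideanSpace ℝ (Fin 3) in 𝓝 (t₀, y₀), z.1 < 0 := by
    filter_upwards [hslab] with z hz
    exact (mem_prod.1 hz).1
  filter_upwards [hslope, ht] with z hz hzt
  have hE1 := (hall z.1 hzt).2.2.2.2.2 z.2
  have h2 := hz (EuclideanSpace.single 2 1)
  have he : (EuclideanSpace.single (2 : Fin 3) (1 : ℝ) : EuclideanSpace ℝ (Fin 3)) 2 = 1 := by simp
  rw [he, one_mul] at h2
  linarith

end Summit.NavierStokesRegularity.NavierStokesRegularity.Theorems.PoloidalWindowDoorLrcModEntireStructureFunctionT0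

end
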